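import Summits.QuantumFields.BalabanUV.T4Continuum.Support.NE3LocalCrudeWPair
import Summits.QuantumFields.BalabanUV.T4Continuum.Support.NE3LocalCrudeRate
import HarnessLib

/-!
# T⁴ programme, node NE3 — the LOCAL half, reading (D), crude fixed-torus route IN THE η-WEIGHTED CURRENCY (D-CRUDE-w),
# part 2: the pure-real core and THE PER-LEVEL (D) BOUND `≤ K_w·(L⁻¹)^k` IN PAIR FORM (d = 4)

NE3 prover lineage P1, gen 20 (cell `pub-balaban`, unit `b2b-balaban-t4-ne3-p1`, row NE3 OWNER).  Sequel of part 1
(`NE3LocalCrudeWPair`); twin of (53S) `NE3LocalCrudeRate` in the weighted currency of the surviving variant (R3).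

CONTENT (0 def, 0 sorry): §1 **`crudeW_core`** — pure real arithmetic over opaque atoms: with `s = L^k ≥ 1`, a window of
`Y ≤ W₀·s⁴` sites, radii `a_B = b/(Ls)²`, `γ = c/(Ls)³`, averaged radius `av = L²a_B + 226(320L²a_B)²`, a weighted energy
`0 ≤ E ≤ R/s` and a sup datum `0 ≤ α ≤ σ/s`, part 1's bracket at `d = 4` is `≤ K_w·(1/s)`,
`K_w = wl·W₀·(2500L³P(bc + c²) + b³) + b̃·√(W₀P)·R + (1 + 14P·b̃ + 56P·σ + 912P·σ²(e^σ)²)·R²`, `b̃ = b + 23142400b²`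
(NO smallness of `σ`: the exponential factors are carried); §2 **`abs_loc_succ_sub_le_of_pairW`** — for `d = 4`, `L, N ≥ 1`,
`0 ≤ b, c, C, σ, W₀`, `20480·L²·b ≤ 1`, a run-(k+1) configuration `U_B` with `RegularSup 4 L N b c (k+1) U_B`, ANY configuration
`U_A`, a site gauge `u` and a skew `(N·L^k)`-periodic direction `Z` with `gaugeAct u U_A = vary W Z 1` (`W = rescale L (bavg L U_B)`),
the WEIGHTED energy bound `energyNormW L k W Z (periodBox (N·L^k)) ≤ C·residualScale 4 L N b (gradConst 4 c) k` and the sup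
bound `‖Z(b)‖ ≤ σ·(L⁻¹)^k` (the two conjuncts of T-E_w♯, in PAIR form — no `∃`, no minimiser hypothesis is used), on every window
`Y ⊆ periodBox (N·L^k)` with `#Y ≤ W₀·(L^k)^4`:  `|A_Y(U_A) − A_{B(Y)}(U_B)| ≤ K_w·(L⁻¹)^k`,
`R = C·wallConst·N²·(√(gradConst 4 c)·dualC2 + 2b²·dualC1)` (`residualScale_four_le`), `P = #Pl`, `wl = wallConstLoc 4 L`.

HONEST FRAMING.  Bookkeeping in OUR repaired frame; the energy and sup bounds are HYPOTHESES on the displayed pair (their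
shape-level form T-E_w♯ = `NE3EnergyWeightedSupShape.NE3EnergyRateWSup` is consumed only in part 3); nothing printed is a
hypothesis; NE3 NOT proved; spine PROVED 0∕9; finite T⁴ rung (B)+1 — NOT infinite volume, NOT mass gap, NOT `BetaPertH`, NOT
Clay.  PLACEMENT: `Summits/QuantumFields/BalabanUV/`.  HONEST DEPENDENCY (cell page 1): continuum YM on T⁴ ⇐ BetaPertH ∧ nine
spine estimates (0/9 proved); BetaPertH ⇐ (D1) ∧ (D4) ∧ CAP+tail; G-an2-4 gates asym, D1 and NE2/3/4.
-/

set_option autoImplicit false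

open scoped BigOperators Matrix Matrix.Norms.L2Operator
open NormedSpace Finset

namespace Summit.QuantumFields.BalabanUV.T4Continuum.NE3LocalCrudeWRate

open Literature.MathematicalPhysics.QuantumFieldTheory.Balaban1983to89
open B7Prop1Explicit B7Prop2Explicit MatrixLog UnitaryModel
open T4AveragingDeficitWall hiding Site Plane Plaq Bond
open T4AveragingDeficitWallBoundary (periodBox)
open T4AveragingDeficitNonAbelian (wallConstLoc)
open AveragingDeficitPeriodicCounting (IsPeriodicDir)
open AveragingDeficitDualResidual (dualC1 dualC2)
open AveragingDeficitDerivWallProof (wallConst wallConst_nonneg)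
open MinimalActionLevels (avgRadius)
open MinimalActionRefine (RegularSup gradConst gradConst_nonneg)
open NE3EnergyShapes (residualScale dualC1_nonneg dualC2_nonneg)
open NE3EnergyWeightedShapes (energyNormW energyNormW_nonneg)
open NE3LocalCrudeRate (residualScale_four_le)
open NE3LocalCrudeWPair (abs_windowAction_sub_le_of_regularSup_sharp)

noncomputable section

variable {n : Type*} [Fintype n] [DecidableEq n] [Nonempty n]

/-! ## §1 The pure-real core of the per-level window bound, weighted currency -/

omit [Fintype n] [DecidableEq n] [Nonempty n] in
/-- **Pure-real core of §2** (opaque atoms).  With `s = L^k ≥ 1`, `L ≥ 1`, `0 ≤ Q ≤ 5L`, a window of `Y ≤ W₀·s⁴` sites, radii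
`a_B = b/(Ls)²`, `γ = c/(Ls)³`, averaged radius `av = L²a_B + 226(320L²a_B)²`, a weighted energy `0 ≤ E ≤ R/s` and a sup
datum `0 ≤ α ≤ σ/s` (`σ ≥ 0`), part 1's right-hand side at `d = 4` (weight level `k`: the factor `s²` on the bond term) is
`≤ K_w·(1/s)`, `K_w = wl·W₀·(2500L³P(bc + c²) + b³) + b̃√(W₀P)·R + (1 + 14P·b̃ + 56P·σ + 912P·σ²(e^σ)²)·R²`,
`b̃ = b + 23142400b²`. [folklore] -/
theorem crudeW_core {wl L Q s W₀ P b c Y aB γ av E R α σ : ℝ} (hwl : 0 ≤ wl) (hL : 1 ≤ L) (hQ0 : 0 ≤ Q) (hQ : Q ≤ 5 * L)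
    (hs : 1 ≤ s) (hW₀ : 0 ≤ W₀) (hP : 0 ≤ P) (hb : 0 ≤ b) (hc : 0 ≤ c) (hY0 : 0 ≤ Y) (hY : Y ≤ W₀ * s ^ 4)
    (haB : aB = b / (L * s) ^ 2) (hγ : γ = c / (L * s) ^ 3) (hav : av = L ^ 2 * aB + 226 * (320 * L ^ 2 * aB) ^ 2)
    (hE0 : 0 ≤ E) (hE : E ≤ R / s) (hα0 : 0 ≤ α) (hσ : 0 ≤ σ) (hα : α ≤ σ / s) :
    wl * (Y * (L ^ 4 * Q ^ 4 * (4 * (P * (aB * γ + γ ^ 2))) + aB ^ 3))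
        + (av * (Real.sqrt (Y * P) * E) + E ^ 2
          + (7 / 2 * av + 14 * α + 228 * α ^ 2 * Real.exp α ^ 2) * (4 * P * (s ^ 2 * E ^ 2)))
      ≤ (wl * W₀ * (2500 * L ^ 3 * P * (b * c + c ^ 2) + b ^ 3)
          + ((b + 23142400 * b ^ 2) * Real.sqrt (W₀ * P) * R
            + (1 + 14 * P * (b + 23142400 * b ^ 2) + 56 * P * σ + 912 * P * σ ^ 2 * Real.exp σ ^ 2) * R ^ 2))
        * (1 / s) := by
  have hL0 : 0 < L := by linarith
  have hs0 : 0 < s := by linarith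
  have haB0 : 0 ≤ aB := by rw [haB]; positivity
  have hγ0 : 0 ≤ γ := by rw [hγ]; positivity
  -- reciprocal comparisons
  have hss : s ≤ s ^ 2 := by
    calc s = s * 1 := (mul_one s).symm
      _ ≤ s * s := mul_le_mul_of_nonneg_left hs hs0.le
      _ = s ^ 2 := (sq s).symm
  have i2 : 1 / (L ^ 6 * s ^ 2) ≤ 1 / s := by
    apply one_div_le_one_div_of_le hs0
    have h6 : (1 : ℝ) ≤ L ^ 6 := one_le_pow₀ hL
    calc s ≤ s ^ 2 := hss
      _ = 1 * s ^ 2 := (one_mul _).symm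
      _ ≤ L ^ 6 * s ^ 2 := mul_le_mul_of_nonneg_right h6 (by positivity)
  have i3 : 1 / s ^ 2 ≤ 1 / s := one_div_le_one_div_of_le hs0 hss
  -- `L⁴ Q⁴ ≤ 625 L⁸`
  have hQ4 : L ^ 4 * Q ^ 4 ≤ 625 * L ^ 8 := by
    have h := pow_le_pow_left₀ hQ0 hQ 4
    have hL4 : (0 : ℝ) ≤ L ^ 4 := by positivity
    calc L ^ 4 * Q ^ 4 ≤ L ^ 4 * (5 * L) ^ 4 := mul_le_mul_of_nonneg_left h hL4
      _ = 625 * L ^ 8 := by ring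
  -- (i) the mixed window term `L⁴Q⁴·Y·a_Bγ ≤ 625 L³ W₀ bc /s`
  have t1 : L ^ 4 * Q ^ 4 * (Y * (aB * γ)) ≤ 625 * L ^ 3 * W₀ * (b * c) * (1 / s) := by
    have e : s ^ 4 * (aB * γ) = b * c * (1 / (L ^ 5 * s)) := by
      rw [haB, hγ]; field_simp
    have h1 : Y * (aB * γ) ≤ W₀ * (b * c) * (1 / (L ^ 5 * s)) := by
      calc Y * (aB * γ) ≤ W₀ * s ^ 4 * (aB * γ) := mul_le_mul_of_nonneg_right hY (mul_nonneg haB0 hγ0)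
        _ = W₀ * (s ^ 4 * (aB * γ)) := by ring
        _ = W₀ * (b * c) * (1 / (L ^ 5 * s)) := by rw [e]; ring
    have h2 := mul_le_mul hQ4 h1 (by positivity) (by positivity)
    have e2 : 625 * L ^ 8 * (W₀ * (b * c) * (1 / (L ^ 5 * s))) = 625 * L ^ 3 * W₀ * (b * c) * (1 / s) := by
      field_simp
    exact h2.trans (le_of_eq e2)
  -- (ii) the pure gradient window term `L⁴Q⁴·Y·γ² ≤ 625 L³ W₀ c² /s`
  have t2 : L ^ 4 * Q ^ 4 * (Y * γ ^ 2) ≤ 625 * L ^ 3 * W₀ * c ^ 2 * (1 / s) := by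
    have e : s ^ 4 * γ ^ 2 = c ^ 2 * (1 / (L ^ 6 * s ^ 2)) := by
      rw [hγ]; field_simp
    have h1 : Y * γ ^ 2 ≤ W₀ * c ^ 2 * (1 / (L ^ 6 * s ^ 2)) := by
      calc Y * γ ^ 2 ≤ W₀ * s ^ 4 * γ ^ 2 := mul_le_mul_of_nonneg_right hY (sq_nonneg γ)
        _ = W₀ * (s ^ 4 * γ ^ 2) := by ring
        _ = W₀ * c ^ 2 * (1 / (L ^ 6 * s ^ 2)) := by rw [e]; ring
    have h2 := mul_le_mul hQ4 h1 (by positivity) (by positivity)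
    have e2 : 625 * L ^ 8 * (W₀ * c ^ 2 * (1 / (L ^ 6 * s ^ 2))) = 625 * L ^ 2 * W₀ * c ^ 2 * (1 / s ^ 2) := by
      field_simp
    have hL3 : L ^ 2 ≤ L ^ 3 := pow_le_pow_right₀ hL (by norm_num)
    have h3 : 625 * L ^ 2 * W₀ * c ^ 2 ≤ 625 * L ^ 3 * W₀ * c ^ 2 := by
      have := mul_le_mul_of_nonneg_right hL3 (by positivity : (0 : ℝ) ≤ 625 * W₀ * c ^ 2)
      calc 625 * L ^ 2 * W₀ * c ^ 2 = L ^ 2 * (625 * W₀ * c ^ 2) := by ring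
        _ ≤ L ^ 3 * (625 * W₀ * c ^ 2) := this
        _ = 625 * L ^ 3 * W₀ * c ^ 2 := by ring
    have h4 := mul_le_mul h3 i3 (by positivity) (by positivity)
    exact (h2.trans (le_of_eq e2)).trans h4
  -- (iii) the cubic budget `Y·a_B³ ≤ W₀ b³ /s`
  have t3 : Y * aB ^ 3 ≤ W₀ * b ^ 3 * (1 / s) := by
    have e : s ^ 4 * aB ^ 3 = b ^ 3 * (1 / (L ^ 6 * s ^ 2)) := by
      rw [haB]; field_simp
    calc Y * aB ^ 3 ≤ W₀ * s ^ 4 * aB ^ 3 := mul_le_mul_of_nonneg_right hY (pow_nonneg haB0 3)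
      _ = W₀ * (s ^ 4 * aB ^ 3) := by ring
      _ = W₀ * (b ^ 3 * (1 / (L ^ 6 * s ^ 2))) := by rw [e]
      _ ≤ W₀ * (b ^ 3 * (1 / s)) := mul_le_mul_of_nonneg_left (mul_le_mul_of_nonneg_left i2 (pow_nonneg hb 3)) hW₀
      _ = W₀ * b ^ 3 * (1 / s) := by ring
  -- the averaged radius: `av = u + 23142400 u²`, `u = b/s² ≤ b`, `av ≤ b̃/s²`
  have hs2 : (0 : ℝ) < s ^ 2 := by positivity
  have hu' : L ^ 2 * aB = b / s ^ 2 := by rw [haB]; field_simp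
  have eav : av = b / s ^ 2 + 23142400 * (b / s ^ 2) ^ 2 := by
    rw [hav, show (320 : ℝ) * L ^ 2 * aB = 320 * (L ^ 2 * aB) from by ring, hu']; ring
  have hav0 : 0 ≤ av := by rw [hav]; positivity
  have hu : b / s ^ 2 ≤ b := div_le_self hb (one_le_pow₀ hs)
  have hbt : 0 ≤ b + 23142400 * b ^ 2 := by positivity
  have hav_le : av ≤ (b + 23142400 * b ^ 2) * (1 / s ^ 2) := by
    rw [eav]
    have h1 : 23142400 * (b / s ^ 2) ^ 2 ≤ 23142400 * (b * (b / s ^ 2)) := by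
      have : (b / s ^ 2) ^ 2 = (b / s ^ 2) * (b / s ^ 2) := sq _
      rw [this]
      exact mul_le_mul_of_nonneg_left (mul_le_mul_of_nonneg_right hu (by positivity)) (by norm_num)
    have e : (b + 23142400 * b ^ 2) * (1 / s ^ 2) = b / s ^ 2 + 23142400 * (b * (b / s ^ 2)) := by
      field_simp
    rw [e]; linarith
  -- (iv) the linear curl term `av·√(YP)·E ≤ b̃·√(W₀P)·R /s`
  have hsq : Real.sqrt (Y * P) ≤ s ^ 2 * Real.sqrt (W₀ * P) := by
    have h1 : Y * P ≤ (s ^ 2) ^ 2 * (W₀ * P) := by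
      calc Y * P ≤ W₀ * s ^ 4 * P := mul_le_mul_of_nonneg_right hY hP
        _ = (s ^ 2) ^ 2 * (W₀ * P) := by ring
    calc Real.sqrt (Y * P) ≤ Real.sqrt ((s ^ 2) ^ 2 * (W₀ * P)) := Real.sqrt_le_sqrt h1
      _ = s ^ 2 * Real.sqrt (W₀ * P) := by rw [Real.sqrt_mul (by positivity), Real.sqrt_sq (by positivity)]
  have t4 : av * (Real.sqrt (Y * P) * E) ≤ (b + 23142400 * b ^ 2) * Real.sqrt (W₀ * P) * R * (1 / s) := by
    have h1 : Real.sqrt (Y * P) * E ≤ s ^ 2 * Real.sqrt (W₀ * P) * (R / s) :=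
      mul_le_mul hsq hE hE0 (by positivity)
    have h2 := mul_le_mul hav_le h1 (by positivity) (by positivity)
    have e : (b + 23142400 * b ^ 2) * (1 / s ^ 2) * (s ^ 2 * Real.sqrt (W₀ * P) * (R / s))
        = (b + 23142400 * b ^ 2) * Real.sqrt (W₀ * P) * R * (1 / s) := by
      field_simp
    exact h2.trans (le_of_eq e)
  -- (v) the squared curl term `E² ≤ R²/s`
  have hE2 : E ^ 2 ≤ R ^ 2 * (1 / s ^ 2) := by
    have h1 : E ^ 2 ≤ (R / s) ^ 2 := pow_le_pow_left₀ hE0 hE 2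
    have e : (R / s) ^ 2 = R ^ 2 * (1 / s ^ 2) := by field_simp
    exact h1.trans (le_of_eq e)
  have t5 : E ^ 2 ≤ R ^ 2 * (1 / s) := hE2.trans (mul_le_mul_of_nonneg_left i3 (sq_nonneg R))
  -- (vi) the weighted bond term: `s²E² ≤ R²`
  have hsE : s ^ 2 * E ^ 2 ≤ R ^ 2 := by
    have h1 : s * E ≤ R := by
      have := mul_le_mul_of_nonneg_left hE hs0.le
      rwa [mul_div_cancel₀ _ hs0.ne'] at this
    have h0 : 0 ≤ s * E := by positivity
    calc s ^ 2 * E ^ 2 = (s * E) ^ 2 := by ring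
      _ ≤ R ^ 2 := pow_le_pow_left₀ h0 h1 2
  -- the coefficient: `7/2·av + 14α + 228α²(e^α)² ≤ (7/2·b̃ + 14σ + 228σ²(e^σ)²)/s`
  have hασ : α ≤ σ := hα.trans (div_le_self hσ hs)
  have hexp : Real.exp α ≤ Real.exp σ := Real.exp_le_exp.mpr hασ
  have hexp0 : 0 ≤ Real.exp α := (Real.exp_pos α).le
  have hcoef : 7 / 2 * av + 14 * α + 228 * α ^ 2 * Real.exp α ^ 2
      ≤ (7 / 2 * (b + 23142400 * b ^ 2) + 14 * σ + 228 * σ ^ 2 * Real.exp σ ^ 2) * (1 / s) := by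
    have h1 : 7 / 2 * av ≤ 7 / 2 * (b + 23142400 * b ^ 2) * (1 / s) := by
      have := hav_le.trans (mul_le_mul_of_nonneg_left i3 hbt)
      linarith
    have h2 : 14 * α ≤ 14 * σ * (1 / s) := by
      have : σ / s = σ * (1 / s) := by ring
      linarith [hα]
    have h3 : 228 * α ^ 2 * Real.exp α ^ 2 ≤ 228 * σ ^ 2 * Real.exp σ ^ 2 * (1 / s) := by
      have ha2 : α ^ 2 ≤ σ ^ 2 * (1 / s) := by
        have h4 : α ^ 2 ≤ (σ / s) ^ 2 := pow_le_pow_left₀ hα0 hα 2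
        have e : (σ / s) ^ 2 = σ ^ 2 * (1 / s ^ 2) := by field_simp
        exact (h4.trans (le_of_eq e)).trans (mul_le_mul_of_nonneg_left i3 (sq_nonneg σ))
      have he2 : Real.exp α ^ 2 ≤ Real.exp σ ^ 2 := pow_le_pow_left₀ hexp0 hexp 2
      have h5 := mul_le_mul ha2 he2 (by positivity) (by positivity)
      calc 228 * α ^ 2 * Real.exp α ^ 2 = 228 * (α ^ 2 * Real.exp α ^ 2) := by ring
        _ ≤ 228 * (σ ^ 2 * (1 / s) * Real.exp σ ^ 2) := mul_le_mul_of_nonneg_left h5 (by norm_num)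
        _ = 228 * σ ^ 2 * Real.exp σ ^ 2 * (1 / s) := by ring
    linarith
  have hcoef0 : 0 ≤ 7 / 2 * av + 14 * α + 228 * α ^ 2 * Real.exp α ^ 2 := by positivity
  have t6 : (7 / 2 * av + 14 * α + 228 * α ^ 2 * Real.exp α ^ 2) * (4 * P * (s ^ 2 * E ^ 2))
      ≤ (14 * P * (b + 23142400 * b ^ 2) + 56 * P * σ + 912 * P * σ ^ 2 * Real.exp σ ^ 2) * R ^ 2 * (1 / s) := by
    have h1 : 4 * P * (s ^ 2 * E ^ 2) ≤ 4 * P * R ^ 2 := mul_le_mul_of_nonneg_left hsE (by positivity)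
    have h2 := mul_le_mul hcoef h1 (by positivity) (by positivity)
    have e : (7 / 2 * (b + 23142400 * b ^ 2) + 14 * σ + 228 * σ ^ 2 * Real.exp σ ^ 2) * (1 / s) * (4 * P * R ^ 2)
        = (14 * P * (b + 23142400 * b ^ 2) + 56 * P * σ + 912 * P * σ ^ 2 * Real.exp σ ^ 2) * R ^ 2 * (1 / s) := by
      ring
    exact h2.trans (le_of_eq e)
  -- assemble
  have hP4 : (0 : ℝ) ≤ 4 * P := by positivity
  have s12 := mul_le_mul_of_nonneg_left (add_le_add t1 t2) hP4
  have hwin : Y * (L ^ 4 * Q ^ 4 * (4 * (P * (aB * γ + γ ^ 2))) + aB ^ 3)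
      ≤ W₀ * (2500 * L ^ 3 * P * (b * c + c ^ 2) + b ^ 3) * (1 / s) := by
    have e1 : Y * (L ^ 4 * Q ^ 4 * (4 * (P * (aB * γ + γ ^ 2))) + aB ^ 3)
        = 4 * P * (L ^ 4 * Q ^ 4 * (Y * (aB * γ)) + L ^ 4 * Q ^ 4 * (Y * γ ^ 2)) + Y * aB ^ 3 := by ring
    have e2 : W₀ * (2500 * L ^ 3 * P * (b * c + c ^ 2) + b ^ 3) * (1 / s)
        = 4 * P * (625 * L ^ 3 * W₀ * (b * c) * (1 / s) + 625 * L ^ 3 * W₀ * c ^ 2 * (1 / s))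
          + W₀ * b ^ 3 * (1 / s) := by ring
    rw [e1, e2]
    exact add_le_add s12 t3
  have hw := mul_le_mul_of_nonneg_left hwin hwl
  have e3 : (wl * W₀ * (2500 * L ^ 3 * P * (b * c + c ^ 2) + b ^ 3)
        + ((b + 23142400 * b ^ 2) * Real.sqrt (W₀ * P) * R
          + (1 + 14 * P * (b + 23142400 * b ^ 2) + 56 * P * σ + 912 * P * σ ^ 2 * Real.exp σ ^ 2) * R ^ 2)) * (1 / s)
      = wl * (W₀ * (2500 * L ^ 3 * P * (b * c + c ^ 2) + b ^ 3) * (1 / s))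
        + ((b + 23142400 * b ^ 2) * Real.sqrt (W₀ * P) * R * (1 / s) + R ^ 2 * (1 / s)
          + (14 * P * (b + 23142400 * b ^ 2) + 56 * P * σ + 912 * P * σ ^ 2 * Real.exp σ ^ 2) * R ^ 2 * (1 / s)) := by
    ring
  rw [e3]
  exact add_le_add hw (add_le_add (add_le_add t4 t5) t6)

/-! ## §2 The per-level (D) bound in PAIR form (d = 4) -/

/-- **THE PER-LEVEL LOCAL BOUND, READING (D), WEIGHTED CURRENCY, PAIR FORM** (`d = 4`, fixed torus of side `N`, NO localisation).
Let `L, N ≥ 1`, `0 ≤ b, c, C, σ, W₀`, `20480·L²·b ≤ 1`.  For a run-`(k+1)` configuration `U_B` with `RegularSup 4 L N b c (k+1) U_B`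
((H∃)'s regularity slot), ANY configuration `U_A`, a site gauge `u` and a skew `(N·L^k)`-periodic direction `Z` with
`gaugeAct u U_A = vary W Z 1` (`W = rescale L (bavg L U_B)`), the WEIGHTED energy bound
`energyNormW L k W Z (periodBox (N·L^k)) ≤ C·residualScale 4 L N b (gradConst 4 c) k` and the sup bound `‖Z(b)‖ ≤ σ·(L⁻¹)^k`
(the two conjuncts of T-E_w♯ for this pair), and a window `Y ⊆ [0, N·L^k)^4` of at most `W₀·(L^k)^4` sites:
`|A_Y(U_A) − A_{B(Y)}(U_B)| ≤ K_w·(L⁻¹)^k`,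
`K_w = wallConstLoc·W₀·(2500L³·#Pl·(bc + c²) + b³) + b̃·√(W₀·#Pl)·R + (1 + 14#Pl·b̃ + 56#Pl·σ + 912#Pl·σ²(e^σ)²)·R²`,
`b̃ = b + 23142400b²`, `R = C·wallConst·N²·(√(gradConst 4 c)·dualC2 + 2b²·dualC1)` — rate `L⁻¹`, constant `∝ N⁴` (crude). [folklore] -/
theorem abs_loc_succ_sub_le_of_pairW {L N : ℕ} (hL : 1 ≤ L) (hN : 1 ≤ N) {b c C σ W₀ : ℝ} (hb : 0 ≤ b) (hc : 0 ≤ c)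
    (hC : 0 ≤ C) (hσ : 0 ≤ σ) (hW₀ : 0 ≤ W₀) (hbs : 20480 * (L : ℝ) ^ 2 * b ≤ 1) {k : ℕ}
    {UA UB : Site 4 → Fin 4 → (Matrix n n ℂ)ˣ} (hreg : RegularSup 4 L N b c (k + 1) UB)
    {u : Site 4 → (Matrix n n ℂ)ˣ} {Z : Site 4 → Fin 4 → Matrix n n ℂ} (hZ : IsSkewDir Z)
    (hZp : IsPeriodicDir Z ((N * L ^ k : ℕ) : ℤ)) (hrep : gaugeAct u UA = vary (rescale L (bavg L UB)) Z 1)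
    (hE : energyNormW L k (rescale L (bavg L UB)) Z (periodBox (N * L ^ k)) ≤ C * residualScale 4 L N b (gradConst 4 c) k)
    (hZσ : ∀ x κ, ‖Z x κ‖ ≤ σ * ((L : ℝ)⁻¹) ^ k)
    {Y : Finset (Site 4)} (hY : Y ⊆ periodBox (N * L ^ k)) (hYc : (Y.card : ℝ) ≤ W₀ * ((L : ℝ) ^ k) ^ 4) :
    |fineAction UA (Y ×ˢ Finset.univ) - fineAction UB (blockSites L Y ×ˢ Finset.univ)|
      ≤ (wallConstLoc 4 L * W₀
            * (2500 * (L : ℝ) ^ 3 * Fintype.card (T4AveragingDeficitWall.Plane 4) * (b * c + c ^ 2) + b ^ 3)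
          + ((b + 23142400 * b ^ 2) * Real.sqrt (W₀ * Fintype.card (T4AveragingDeficitWall.Plane 4))
              * (C * (wallConst 4 L * (N : ℝ) ^ 2 * (Real.sqrt (gradConst 4 c) * dualC2 4 L + 2 * b ^ 2 * dualC1 4 L)))
            + (1 + 14 * Fintype.card (T4AveragingDeficitWall.Plane 4) * (b + 23142400 * b ^ 2)
                + 56 * Fintype.card (T4AveragingDeficitWall.Plane 4) * σ
                + 912 * Fintype.card (T4AveragingDeficitWall.Plane 4) * σ ^ 2 * Real.exp σ ^ 2)
              * (C * (wallConst 4 L * (N : ℝ) ^ 2 * (Real.sqrt (gradConst 4 c) * dualC2 4 L + 2 * b ^ 2 * dualC1 4 L))) ^ 2))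
        * ((L : ℝ)⁻¹) ^ k := by
  have hL1 : (1 : ℝ) ≤ L := by exact_mod_cast hL
  set s : ℝ := (L : ℝ) ^ k with hsdef
  have hs1 : 1 ≤ s := one_le_pow₀ hL1
  have hs0 : 0 < s := by positivity
  have hθ : ((L : ℝ)⁻¹) ^ k = 1 / s := by rw [hsdef, inv_pow, one_div]
  have hsk : ((L : ℝ) ^ (k + 1)) = L * s := by rw [pow_succ]; ring
  have hM : 1 ≤ N * L ^ k := one_le_mul_of_one_le_of_one_le hN (Nat.one_le_pow k L hL)
  -- the sup datum `α = σ/s`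
  have hα0 : 0 ≤ σ * ((L : ℝ)⁻¹) ^ k := by rw [hθ]; positivity
  -- part 1's two-level read-out on the window, weight level k
  have hbs' : 512 * ((4 : ℕ) + 1 : ℝ) * ((4 : ℕ) + 4 : ℝ) * (L : ℝ) ^ 2 * b ≤ 1 := by push_cast; linarith
  have hmain := abs_windowAction_sub_le_of_regularSup_sharp L hL hb hc hbs' hreg hZ hM hZp hα0 hZσ hrep k hY
  simp only [Nat.cast_ofNat, sub_self, zpow_zero, one_mul, hsk] at hmain
  -- the weighted energy norm is geometric
  set E := energyNormW L k (rescale L (bavg L UB)) Z (periodBox (N * L ^ k)) with hEdef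
  set R₁ := wallConst 4 L * (N : ℝ) ^ 2 * (Real.sqrt (gradConst 4 c) * dualC2 4 L + 2 * b ^ 2 * dualC1 4 L) with hR₁def
  have hR₁ : 0 ≤ R₁ := by
    have := wallConst_nonneg 4 L
    have := dualC1_nonneg 4 L
    have := dualC2_nonneg 4 L
    positivity
  have hE' : E ≤ C * R₁ / s := by
    have h1 := residualScale_four_le hL N b (gradConst_nonneg (d := 4) c) k
    rw [hθ] at h1
    calc E ≤ C * residualScale 4 L N b (gradConst 4 c) k := hE
      _ ≤ C * (R₁ * (1 / s)) := mul_le_mul_of_nonneg_left h1 hC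
      _ = C * R₁ / s := by ring
  -- the pure-real core
  have hQ : (((2 * (2 * L) + 1 : ℕ)) : ℝ) ≤ 5 * L := by push_cast; linarith
  have hav : avgRadius 4 L (b / ((L : ℝ) * s) ^ 2)
      = (L : ℝ) ^ 2 * (b / ((L : ℝ) * s) ^ 2) + 226 * (320 * (L : ℝ) ^ 2 * (b / ((L : ℝ) * s) ^ 2)) ^ 2 := by
    unfold MinimalActionLevels.avgRadius; push_cast; ring
  have hwl : 0 ≤ wallConstLoc 4 L := by
    unfold T4AveragingDeficitNonAbelian.wallConstLoc
    have := T4AveragingDeficitNonAbelian.wallConstNA_nonneg (d := 4) L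
    positivity
  have hασ : σ * ((L : ℝ)⁻¹) ^ k ≤ σ / s := by rw [hθ]; exact le_of_eq (by ring)
  have hcore := crudeW_core (Y := (Y.card : ℝ)) (P := (Fintype.card (T4AveragingDeficitWall.Plane 4) : ℝ))
    hwl hL1 (by positivity) hQ hs1 hW₀ (by positivity) hb hc (by positivity) hYc rfl rfl hav
    (energyNormW_nonneg _ _ _ _ _) hE' hα0 hσ hασ
  rw [hθ]
  exact hmain.trans hcore

end

end Summit.QuantumFields.BalabanUV.T4Continuum.NE3LocalCrudeWRate
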